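import Literature.NumberTheory.ComplexMultiplication.CMTypeRankEvaluationCriterion
import Literature.NumberTheory.ComplexMultiplication.CMTypeRankTypeConjugation
import HarnessLib

/-!
# Same-slot families of CM types: rank additivity ⟺ linear independence of the type vectors, when the odd part of the
# permutation module occurs with multiplicity one (consequences of the evaluation criterion)

Companion of `NumberTheory/ComplexMultiplication/CMTypeRankEvaluationCriterion` (the non-abelian Kubota criterion:
`U(Σ) = ⊕_i U(Φ_i)` — `Hg(∏ A_i) = ∏ Hg(A_i)` — iff in every irreducible `ℚ`-representation `(π, V)` of `G` the
evaluation subspaces `{T(u_1(Φ_i)) : T : ℚ^{E_i} → V equivariant}` are linearly independent) and of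
`CMTypeRankTypeConjugation` §0 (the additivity `∀ i, ext_i U(Φ_i) ≤ U(Σ)` gives `rank(Σ) − 1 = Σ_i (rank(Φ_i) − 1)`).

§0 closes the bookkeeping loop: additivity ⟺ `dim U(Σ) = Σ_i dim U(Φ_i)` ⟺ `rank(Σ) + |I| = Σ_i rank(Φ_i) + 1`
(`forall_map_slotExt_le_iff_finrank_antiSpan_sigmaType_eq`, `…_iff_typeRank_sigmaType_add_card_eq`), so the criterion
speaks about the rank of record.  §§1–3 treat SAME-SLOT families — all slots one `G`-set `X` (one CM field `K`,
`X = Hom(K, ℂ)`; Deligne's CM algebra `K^I`, LNM 900 I Ex. 3.7; the tree's `Pohlmann1968.NondegenerateCMTypeFamilies`),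
types `Φ_i ⊆ X`:

* `linearIndependent_antiVec_one_of_forall_map_slotExt_le` — additivity forces the type vectors `u_1(Φ_i) ∈ ℚ^X` to be
  LINEARLY INDEPENDENT (the criterion's easy direction in the permutation representation `ℚ^X` itself);
* `forall_map_slotExt_le_of_linearIndependent` — the converse under the MULTIPLICITY-ONE hypothesis (M1): there is a
  `G`-stable subspace `A ≤ ℚ^X` containing the `u_1(Φ_i)` and an equivariant projection `P` of `ℚ^X` onto `A` such that
  every equivariant `T : ℚ^X → ℚ^X` with values in `A` is a scalar multiple of `P` (i.e. `A` is absolutely irreducible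
  and occurs once in `ℚ^X`; for CM types `A` = the `ρ`-odd weights, `P` = antisymmetrisation, and (M1) holds e.g. for
  a CM field whose conjugate pairs of embeddings are flipped one at a time by Galois, `CorCM/GenericCMFieldSameFieldFamiliesHodge`).
  The mechanism is Schur's lemma in the form `exists_smul_eq_of_multiplicityOne`: under (M1), for every irreducible
  `(π, V)` all equivariant `ℚ^X → V` agree on `A` up to scalars, and a non-zero one is injective on `A`;
* `forall_map_slotExt_le_iff_linearIndependent` and the capacity bound `card_le_finrank_of_linearIndependent`
  (`|I| ≤ dim A = n` nondegenerate pairwise CM-inequivalent members at most); `…_of_isCMTypeWith` = the CM-type dress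
  with `A` the odd weights.

Complete reducibility is by orthogonal complements for the `G`-invariant dot product (Serre §1.3 Thm. 1, proof), no
Maschke averaging, `G` not assumed finite.  Theorems only: no definition, no named fact, no `sorry`.

## References

* [Serre1977] J.-P. Serre, *Linear Representations of Finite Groups*, GTM 42 (1977), §1.3 Thm. 1, §2.2 Prop. 4 (Schur).
* [Mai1989] L. Mai, *Lower bounds for the ranks of CM types*, J. Number Theory 32 (1989), §2 Prop. 1 (proof).
* [Deligne1982HodgeCycles] P. Deligne, *Hodge cycles on abelian varieties*, LNM 900 (1982), I Ex. 3.7.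
* [Gordon1999HodgeAVSurvey] B. B. Gordon, *A survey of the Hodge conjecture for abelian varieties*, §3, 7.5–7.7.
-/

set_option autoImplicit false

noncomputable section

open scoped BigOperators

universe u v w

namespace Literature.NumberTheory.ComplexMultiplication

variable {G : Type w} [Group G] {I : Type u} {E : I → Type v} [∀ i, MulAction G (E i)]

/-! ### §0 Bookkeeping: additivity ⟺ dimension additivity ⟺ rank additivity -/

section Bookkeeping

variable [DecidableEq I] [Fintype I] [∀ i, Fintype (E i)]

/-- **`ext_i U(Φ_i) ≤ U(Σ)` for all `i` ⟺ `dim U(Σ) = Σ_i dim U(Φ_i)`** (`U(Σ) ≤ ⊕_i U(Φ_i)` always; equality of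
dimensions forces equality). [cite: Gordon1999HodgeAVSurvey, §3 Theorem (1) and 7.7] -/
theorem forall_map_slotExt_le_iff_finrank_antiSpan_sigmaType_eq (Φ : ∀ i, Set (E i)) :
    (∀ i, (antiSpan G (Φ i)).map (slotExt i) ≤ antiSpan G (sigmaType Φ)) ↔
      Module.finrank ℚ (antiSpan G (sigmaType Φ)) = ∑ i, Module.finrank ℚ (antiSpan G (Φ i)) := by
  refine ⟨finrank_antiSpan_sigmaType_eq_of_forall_map_le, fun heq i => ?_⟩
  set R := LinearMap.range (sigmaLift ∘ₗ LinearMap.pi fun j => (antiSpan G (Φ j)).subtype ∘ₗ LinearMap.proj j)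
    with hR
  have hle : antiSpan G (sigmaType Φ) ≤ R := antiSpan_sigmaType_le_range Φ
  have hdim : Module.finrank ℚ R ≤ Module.finrank ℚ (antiSpan G (sigmaType Φ)) := by
    rw [heq]
    calc Module.finrank ℚ R ≤ Module.finrank ℚ (∀ j, antiSpan G (Φ j)) := LinearMap.finrank_range_le _
      _ = ∑ j, Module.finrank ℚ (antiSpan G (Φ j)) := Module.finrank_pi_fintype ℚ
  rw [Submodule.eq_of_le_of_finrank_le hle hdim]
  rintro _ ⟨a, ha, rfl⟩
  refine ⟨(Pi.single i ⟨a, ha⟩ : ∀ j, antiSpan G (Φ j)), ?_⟩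
  change sigmaLift (fun j => ((Pi.single i ⟨a, ha⟩ : ∀ j, antiSpan G (Φ j)) j : E j → ℚ)) =
    sigmaLift (Pi.single i a)
  congr 1
  funext j
  by_cases hji : j = i
  · subst hji
    rw [Pi.single_eq_same, Pi.single_eq_same]
  · rw [Pi.single_eq_of_ne hji, Pi.single_eq_of_ne hji, Submodule.coe_zero]

/-- **Additivity ⟺ `rank(Σ) + |I| = Σ_i rank(Φ_i) + 1`**, i.e. `rank(Σ) − 1 = Σ_i (rank(Φ_i) − 1)`
(`Hg(∏ A_i) = ∏ Hg(A_i)`). [cite: Gordon1999HodgeAVSurvey, §3 Theorem (1) and 7.7] -/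
theorem forall_map_slotExt_le_iff_typeRank_sigmaType_add_card_eq [Nonempty I] [∀ i, Nonempty (E i)] {ρ : G}
    {Φ : ∀ i, Set (E i)} (h : ∀ i, IsCMTypeWith ρ (Φ i)) :
    (∀ i, (antiSpan G (Φ i)).map (slotExt i) ≤ antiSpan G (sigmaType Φ)) ↔
      typeRank G (sigmaType Φ) + Fintype.card I = (∑ i, typeRank G (Φ i)) + 1 := by
  rw [forall_map_slotExt_le_iff_finrank_antiSpan_sigmaType_eq]
  obtain ⟨i₀⟩ := ‹Nonempty I›
  haveI : Nonempty (Σ i, E i) := ⟨⟨i₀, Classical.arbitrary (E i₀)⟩⟩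
  rw [(IsCMTypeWith.sigmaType h).typeRank_eq_finrank_antiSpan_add_one,
    Finset.sum_congr rfl fun i _ => (h i).typeRank_eq_finrank_antiSpan_add_one, Finset.sum_add_distrib,
    Finset.sum_const, Finset.card_univ, smul_eq_mul, mul_one]
  omega

/-- **For nondegenerate members, additivity ⟺ the family is nondegenerate** (`rank(Σ) = |⊔ E_i|/2 + 1`).
[cite: Gordon1999HodgeAVSurvey, 7.5–7.6] -/
theorem forall_map_slotExt_le_iff_typeRank_sigmaType_eq [Nonempty I] [∀ i, Nonempty (E i)] {ρ : G}
    {Φ : ∀ i, Set (E i)} (h : ∀ i, IsCMTypeWith ρ (Φ i)) (hnd : ∀ i, typeRank G (Φ i) = Fintype.card (E i) / 2 + 1) :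
    (∀ i, (antiSpan G (Φ i)).map (slotExt i) ≤ antiSpan G (sigmaType Φ)) ↔
      typeRank G (sigmaType Φ) = Fintype.card (Σ i, E i) / 2 + 1 := by
  rw [forall_map_slotExt_le_iff_typeRank_sigmaType_add_card_eq h, card_sigma_div_two h,
    Finset.sum_congr rfl fun i _ => hnd i, Finset.sum_add_distrib, Finset.sum_const, Finset.card_univ, smul_eq_mul,
    mul_one]
  omega

end Bookkeeping

/-! ### §1 Same-slot families: additivity forces independent type vectors -/

section SameSlot

variable {X : Type v} [MulAction G X]

/-- `u_1(Ψ) ≠ 0` on a nonempty index set (its values are `±1`). [folklore] -/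
private theorem antiVec_one_ne_zero [Nonempty X] (Ψ : Set X) : antiVec Ψ (1 : G) ≠ 0 := fun h => by
  obtain ⟨x⟩ := ‹Nonempty X›
  have hx := congrFun h x
  simp only [antiVec, Pi.zero_apply] at hx
  by_cases hm : (1 : G) • x ∈ Ψ
  · rw [translateInd_of_mem hm] at hx; norm_num at hx
  · rw [translateInd_of_not_mem hm] at hx; norm_num at hx

variable [DecidableEq I] [Fintype I]

/-- **In an additive SAME-SLOT family the type vectors `u_1(Φ_i) ∈ ℚ^X` are linearly independent** (the evaluation
criterion in the permutation representation `ℚ^X`, `T_i = c_i · id`). [cite: Mai1989, §2 Prop. 1 (proof)] -/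
theorem linearIndependent_antiVec_one_of_forall_map_slotExt_le [Nonempty X] (Φ : I → Set X)
    (hadd : ∀ i, (antiSpan G (Φ i)).map (slotExt (E := fun _ : I => X) i) ≤
      antiSpan G (sigmaType (E := fun _ : I => X) Φ)) :
    LinearIndependent ℚ fun i => antiVec (Φ i) (1 : G) := by
  let π : Representation ℚ G (X → ℚ) :=
    { toFun := fun g => LinearMap.funLeft ℚ ℚ fun x : X => g⁻¹ • x
      map_one' := by ext f x; simp
      map_mul' := fun g h => by ext f x; simp [mul_smul] }
  have key := linearIndependent_eval_of_forall_map_slotExt_le (E := fun _ : I => X) Φ hadd π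
    (fun _ => LinearMap.id) (fun _ _ _ => rfl) Finset.univ (fun i _ => antiVec_one_ne_zero (Φ i))
  exact (key.comp (fun i : I => (⟨i, Finset.mem_univ i⟩ : (Finset.univ : Finset I)))
    fun i j hij => congrArg Subtype.val hij)

/-! ### §2 Schur's lemma for a multiplicity-one constituent of the permutation module -/

variable [Fintype X]

/-- The dot product on `ℚ^X` is `G`-invariant. [cite: Serre1977, §1.3 Thm. 1 (proof)] -/
private theorem dotProduct_comp_smul' (f f' : X → ℚ) (g : G) :
    (fun x => f (g • x)) ⬝ᵥ (fun x => f' (g • x)) = f ⬝ᵥ f' :=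
  Fintype.sum_equiv (MulAction.toPerm g) _ _ fun _ => rfl

/-- The orthogonal complement of a stable subspace is stable. [cite: Serre1977, §1.3 Thm. 1 (proof)] -/
private theorem comp_smul_mem_orthogonal' {W : Submodule ℚ (X → ℚ)}
    (hW : ∀ g : G, ∀ f ∈ W, (fun x => f (g • x)) ∈ W) {m : X → ℚ}
    (hm : m ∈ LinearMap.BilinForm.orthogonal (dotProductBilin ℚ ℚ) W) (g : G) :
    (fun x => m (g • x)) ∈ LinearMap.BilinForm.orthogonal (dotProductBilin ℚ ℚ) W := by
  rw [LinearMap.BilinForm.mem_orthogonal_iff] at hm ⊢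
  intro n hn
  have h1 := hm (fun x => n (g⁻¹ • x)) (hW g⁻¹ n hn)
  change _ ⬝ᵥ _ = 0 at h1
  change n ⬝ᵥ _ = 0
  rw [← dotProduct_comp_smul' (fun x => n (g⁻¹ • x)) m g] at h1
  simpa only [inv_smul_smul] using h1

/-- Every subspace of `ℚ^X` is complemented by its orthogonal complement (the dot product is positive definite).
[cite: Serre1977, §1.3 Thm. 1 (proof)] -/
private theorem isCompl_orthogonal' (W : Submodule ℚ (X → ℚ)) :
    IsCompl W (LinearMap.BilinForm.orthogonal (dotProductBilin ℚ ℚ) W) := by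
  refine LinearMap.BilinForm.isCompl_orthogonal_of_restrict_nondegenerate (fun x y h => ?_) ⟨fun m hm => ?_, fun m hm => ?_⟩
  · change x ⬝ᵥ y = 0 at h
    change y ⬝ᵥ x = 0
    rwa [dotProduct_comm]
  all_goals
    have h := hm m
    rw [LinearMap.BilinForm.restrict_apply] at h
    change (m : X → ℚ) ⬝ᵥ (m : X → ℚ) = 0 at h
    exact Subtype.ext (dotProduct_self_eq_zero.1 h)

/-- **Multiplicity one ⟹ `A` is irreducible**: under (M1) every `G`-stable subspace of `A` is `0` or `A` (apply (M1) to
the equivariant orthogonal projection onto it). [cite: Serre1977, §1.3 Thm. 1 and §2.2 Prop. 4] -/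
theorem eq_bot_or_eq_of_multiplicityOne {A : Submodule ℚ (X → ℚ)} (P : (X → ℚ) →ₗ[ℚ] (X → ℚ))
    (hPid : ∀ a ∈ A, P a = a)
    (hM1 : ∀ T : (X → ℚ) →ₗ[ℚ] (X → ℚ), (∀ (g : G) (f : X → ℚ), T (fun x => f (g⁻¹ • x)) = fun x => T f (g⁻¹ • x)) →
      (∀ f, T f ∈ A) → ∃ c : ℚ, ∀ f, T f = c • P f)
    {W : Submodule ℚ (X → ℚ)} (hWA : W ≤ A) (hWst : ∀ g : G, ∀ f ∈ W, (fun x => f (g • x)) ∈ W) :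
    W = ⊥ ∨ W = A := by
  have hcW := isCompl_orthogonal' W
  let Q : (X → ℚ) →ₗ[ℚ] (X → ℚ) := W.subtype ∘ₗ W.projectionOnto _ hcW
  have hQ : ∀ p ∈ W, ∀ q ∈ LinearMap.BilinForm.orthogonal (dotProductBilin ℚ ℚ) W, Q (p + q) = p :=
    fun p hp q hq => by
      simp only [Q, LinearMap.comp_apply, map_add, Submodule.projectionOnto_apply_of_mem_left hcW hp,
        Submodule.projectionOnto_apply_of_mem_right hcW hq, Submodule.coe_subtype, Submodule.coe_zero, add_zero]
  have hQst : ∀ (g : G) (f : X → ℚ), Q (fun x => f (g⁻¹ • x)) = fun x => Q f (g⁻¹ • x) := fun g f => by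
    obtain ⟨p, hp, q, hq, rfl⟩ := Submodule.mem_sup.1 (hcW.sup_eq_top.symm ▸ Submodule.mem_top (x := f))
    have hsplit : (fun x => (p + q) (g⁻¹ • x)) = (fun x => p (g⁻¹ • x)) + fun x => q (g⁻¹ • x) := rfl
    rw [hsplit, hQ _ (hWst g⁻¹ p hp) _ (comp_smul_mem_orthogonal' hWst hq g⁻¹), hQ p hp q hq]
  have hQA : ∀ f, Q f ∈ A := fun f => hWA (W.projectionOnto _ hcW f).2
  obtain ⟨c, hc⟩ := hM1 Q hQst hQA
  by_cases hc0 : c = 0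
  · left
    rw [eq_bot_iff]
    intro w hw
    have : Q w = w := by simpa only [add_zero] using hQ w hw 0 (Submodule.zero_mem _)
    rw [Submodule.mem_bot, ← this, hc, hc0, zero_smul]
  · right
    refine le_antisymm hWA fun a ha => ?_
    have h1 : Q a = c • a := by rw [hc, hPid a ha]
    have h2 : a = c⁻¹ • Q a := by rw [h1, smul_smul, inv_mul_cancel₀ hc0, one_smul]
    rw [h2]
    exact W.smul_mem _ (W.projectionOnto _ hcW a).2

/-- **Schur's lemma for the multiplicity-one constituent `A`.**  Under (M1), for every IRREDUCIBLE representation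
`(π, V)` and every equivariant `T : ℚ^X → V` not vanishing on `A`: `T` is injective on `A`, and every equivariant
`T' : ℚ^X → V` is a scalar multiple of `T` on `A`. [cite: Serre1977, §2.2 Prop. 4] -/
theorem exists_smul_eq_of_multiplicityOne {A : Submodule ℚ (X → ℚ)} (P : (X → ℚ) →ₗ[ℚ] (X → ℚ))
    (hPeq : ∀ (g : G) (f : X → ℚ), P (fun x => f (g⁻¹ • x)) = fun x => P f (g⁻¹ • x))
    (hPA : ∀ f, P f ∈ A) (hPid : ∀ a ∈ A, P a = a)
    (hM1 : ∀ T : (X → ℚ) →ₗ[ℚ] (X → ℚ), (∀ (g : G) (f : X → ℚ), T (fun x => f (g⁻¹ • x)) = fun x => T f (g⁻¹ • x)) →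
      (∀ f, T f ∈ A) → ∃ c : ℚ, ∀ f, T f = c • P f)
    {V : Type*} [AddCommGroup V] [Module ℚ V] (π : Representation ℚ G V) (hirr : π.IsIrreducible)
    (T : (X → ℚ) →ₗ[ℚ] V) (hT : ∀ (g : G) (f : X → ℚ), T (fun x => f (g⁻¹ • x)) = π g (T f))
    (hT0 : ¬ ∀ a ∈ A, T a = 0) :
    (∀ a ∈ A, T a = 0 → a = 0) ∧
      ∀ T' : (X → ℚ) →ₗ[ℚ] V, (∀ (g : G) (f : X → ℚ), T' (fun x => f (g⁻¹ • x)) = π g (T' f)) →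
        ∃ c : ℚ, ∀ a ∈ A, T' a = c • T a := by
  -- `A` is stable
  have hAst : ∀ g : G, ∀ a ∈ A, (fun x => a (g • x)) ∈ A := fun g a ha => by
    have := hPeq g⁻¹ a
    rw [inv_inv, hPid a ha] at this
    rw [← this]
    exact hPA _
  -- `T` is injective on `A`: `A ∩ ker T` is a proper stable subspace of the irreducible `A`
  have hinj : ∀ a ∈ A, T a = 0 → a = 0 := by
    have hK : A ⊓ LinearMap.ker T = ⊥ ∨ A ⊓ LinearMap.ker T = A :=
      eq_bot_or_eq_of_multiplicityOne (G := G) P hPid hM1 inf_le_left fun g f hf => ⟨hAst g f hf.1, by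
        have h2 : T f = 0 := hf.2
        change T (fun x => f (g • x)) = 0
        have := hT g⁻¹ f
        rw [inv_inv] at this
        rw [this, h2, map_zero]⟩
    rcases hK with hK | hK
    · intro a ha hTa
      have : a ∈ A ⊓ LinearMap.ker T := ⟨ha, hTa⟩
      rwa [hK, Submodule.mem_bot] at this
    · exact (hT0 fun a ha => (hK.symm ▸ ha : a ∈ A ⊓ LinearMap.ker T).2).elim
  refine ⟨hinj, fun T' hT' => ?_⟩
  -- `T(A) = V` by irreducibility of `V`
  have hsurj : A.map T = ⊤ := by
    let S : Subrepresentation π := ⟨A.map T, fun g v hv => by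
      obtain ⟨a, ha, rfl⟩ := hv
      refine ⟨fun x => a (g⁻¹ • x), hAst g⁻¹ a ha, hT g a⟩⟩
    rcases hirr.eq_bot_or_eq_top S with hS | hS
    · exfalso
      apply hT0
      intro a ha
      have : T a ∈ (S : Subrepresentation π).toSubmodule := ⟨a, ha, rfl⟩
      rw [hS] at this
      exact (Submodule.mem_bot ℚ).1 this
    · exact congrArg Subrepresentation.toSubmodule hS
  -- the equivariant isomorphism `e : A ≃ V` and the pulled-back map `φ = e⁻¹ ∘ T' ∘ P : ℚ^X → A ≤ ℚ^X`
  have hbij : Function.Bijective (T.domRestrict A) := by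
    refine ⟨fun a b hab => Subtype.ext ?_, fun v => ?_⟩
    · have h : T (a - b : A) = 0 := by
        rw [Submodule.coe_sub, map_sub]
        exact sub_eq_zero.2 hab
      exact sub_eq_zero.1 (hinj _ (a - b).2 h)
    · have hv : v ∈ A.map T := hsurj ▸ Submodule.mem_top
      obtain ⟨a, ha, rfl⟩ := hv
      exact ⟨⟨a, ha⟩, rfl⟩
  let e : A ≃ₗ[ℚ] V := LinearEquiv.ofBijective (T.domRestrict A) hbij
  have he : ∀ a : A, e a = T a := fun a => rfl
  have hesymm : ∀ (g : G) (v : V), (e.symm (π g v) : X → ℚ) = fun x => (e.symm v : X → ℚ) (g⁻¹ • x) := fun g v => by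
    have h1 : e ⟨fun x => (e.symm v : X → ℚ) (g⁻¹ • x), hAst g⁻¹ _ (e.symm v).2⟩ = π g v := by
      rw [he]
      change T (fun x => (e.symm v : X → ℚ) (g⁻¹ • x)) = π g v
      rw [hT g, ← he, LinearEquiv.apply_symm_apply]
    have h2 := congrArg e.symm h1
    rw [LinearEquiv.symm_apply_apply] at h2
    rw [← h2]
  let φ : (X → ℚ) →ₗ[ℚ] (X → ℚ) := A.subtype ∘ₗ e.symm.toLinearMap ∘ₗ T' ∘ₗ P
  have hφeq : ∀ (g : G) (f : X → ℚ), φ (fun x => f (g⁻¹ • x)) = fun x => φ f (g⁻¹ • x) := fun g f => by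
    simp only [φ, LinearMap.comp_apply, hPeq g f, hT' g, LinearEquiv.coe_coe, Submodule.coe_subtype, hesymm]
  have hφA : ∀ f, φ f ∈ A := fun f => (e.symm (T' (P f))).2
  obtain ⟨c, hc⟩ := hM1 φ hφeq hφA
  refine ⟨c, fun a ha => ?_⟩
  have h1 : (e.symm (T' a) : X → ℚ) = c • a := by
    have := hc a
    simp only [φ, LinearMap.comp_apply, LinearEquiv.coe_coe, Submodule.coe_subtype, hPid a ha] at this
    exact this
  have h2 : e.symm (T' a) = c • (⟨a, ha⟩ : A) := Subtype.ext h1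
  have h3 := congrArg e h2
  rw [LinearEquiv.apply_symm_apply, map_smul, he] at h3
  exact h3

/-! ### §3 Same-slot families under multiplicity one: additivity ⟺ independent type vectors -/

omit [DecidableEq I] [Fintype I] [Fintype X] in
/-- Restating independence of the type vectors inside `A`. [folklore] -/
private theorem linearIndependent_mk {A : Submodule ℚ (X → ℚ)} (Φ : I → Set X) (hu : ∀ i, antiVec (Φ i) (1 : G) ∈ A)
    (hli : LinearIndependent ℚ fun i => antiVec (Φ i) (1 : G)) :
    LinearIndependent ℚ fun i => (⟨antiVec (Φ i) (1 : G), hu i⟩ : A) :=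
  LinearIndependent.of_comp A.subtype (by exact hli)

/-- **Multiplicity one: linearly independent type vectors ⟹ additivity `U(Σ) = ⊕_i U(Φ_i)`** for a same-slot family
(in each irreducible `V` all equivariant `ℚ^X → V` agree on `A ∋ u_1(Φ_i)` up to scalars `c_i`, and a non-zero one is
injective on `A`, so `Σ_i T_i(u_1(Φ_i)) = T(Σ_i c_i u_1(Φ_i)) = 0` forces `c_i = 0`). [cite: Mai1989, §2 Prop. 1 (proof)]
[cite: Serre1977, §2.2 Prop. 4] -/
theorem forall_map_slotExt_le_of_linearIndependent {A : Submodule ℚ (X → ℚ)} (P : (X → ℚ) →ₗ[ℚ] (X → ℚ))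
    (hPeq : ∀ (g : G) (f : X → ℚ), P (fun x => f (g⁻¹ • x)) = fun x => P f (g⁻¹ • x))
    (hPA : ∀ f, P f ∈ A) (hPid : ∀ a ∈ A, P a = a)
    (hM1 : ∀ T : (X → ℚ) →ₗ[ℚ] (X → ℚ), (∀ (g : G) (f : X → ℚ), T (fun x => f (g⁻¹ • x)) = fun x => T f (g⁻¹ • x)) →
      (∀ f, T f ∈ A) → ∃ c : ℚ, ∀ f, T f = c • P f)
    (Φ : I → Set X) (hu : ∀ i, antiVec (Φ i) (1 : G) ∈ A) (hli : LinearIndependent ℚ fun i => antiVec (Φ i) (1 : G)) :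
    ∀ i, (antiSpan G (Φ i)).map (slotExt (E := fun _ : I => X) i) ≤ antiSpan G (sigmaType (E := fun _ : I => X) Φ) := by
  refine forall_map_slotExt_le_of_forall_irreducible (E := fun _ : I => X) Φ fun V _ _ _ π hirr T hT hsum => ?_
  by_cases hall : ∀ j, ∀ a ∈ A, T j a = 0
  · exact fun j => hall j _ (hu j)
  push Not at hall
  obtain ⟨j₀, hj₀⟩ := hall
  have hj₀' : ¬ ∀ a ∈ A, T j₀ a = 0 := by
    push Not
    exact hj₀
  obtain ⟨hinj, hsc⟩ := exists_smul_eq_of_multiplicityOne P hPeq hPA hPid hM1 π hirr (T j₀) (hT j₀) hj₀'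
  choose c hc using fun j => hsc (T j) (hT j)
  have hzero : ∑ j, c j • antiVec (Φ j) (1 : G) = 0 := by
    refine hinj _ (A.sum_mem fun j _ => A.smul_mem _ (hu j)) ?_
    rw [map_sum]
    simpa only [map_smul, ← hc _ _ (hu _)] using hsum
  have hc0 := (Fintype.linearIndependent_iff.1 hli) c hzero
  intro j
  rw [hc j _ (hu j), hc0 j, zero_smul]

/-- **Same-slot families under multiplicity one: `U(Σ) = ⊕_i U(Φ_i)` ⟺ the type vectors `u_1(Φ_i)` are linearly
independent.** [cite: Mai1989, §2 Prop. 1 (proof)] [cite: Serre1977, §2.2 Prop. 4] -/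
theorem forall_map_slotExt_le_iff_linearIndependent [Nonempty X] {A : Submodule ℚ (X → ℚ)}
    (P : (X → ℚ) →ₗ[ℚ] (X → ℚ)) (hPeq : ∀ (g : G) (f : X → ℚ), P (fun x => f (g⁻¹ • x)) = fun x => P f (g⁻¹ • x))
    (hPA : ∀ f, P f ∈ A) (hPid : ∀ a ∈ A, P a = a)
    (hM1 : ∀ T : (X → ℚ) →ₗ[ℚ] (X → ℚ), (∀ (g : G) (f : X → ℚ), T (fun x => f (g⁻¹ • x)) = fun x => T f (g⁻¹ • x)) →
      (∀ f, T f ∈ A) → ∃ c : ℚ, ∀ f, T f = c • P f)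
    (Φ : I → Set X) (hu : ∀ i, antiVec (Φ i) (1 : G) ∈ A) :
    (∀ i, (antiSpan G (Φ i)).map (slotExt (E := fun _ : I => X) i) ≤ antiSpan G (sigmaType (E := fun _ : I => X) Φ)) ↔
      LinearIndependent ℚ fun i => antiVec (Φ i) (1 : G) :=
  ⟨linearIndependent_antiVec_one_of_forall_map_slotExt_le Φ,
    forall_map_slotExt_le_of_linearIndependent P hPeq hPA hPid hM1 Φ hu⟩

omit [DecidableEq I] [Fintype X] in
/-- **Capacity**: a same-slot family with linearly independent type vectors inside `A` has at most `dim A` members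
(for CM types, `dim A = n = [K:ℚ]/2`). [cite: Gordon1999HodgeAVSurvey, 7.7] -/
theorem card_le_finrank_of_linearIndependent {A : Submodule ℚ (X → ℚ)} [FiniteDimensional ℚ A] (Φ : I → Set X)
    (hu : ∀ i, antiVec (Φ i) (1 : G) ∈ A) (hli : LinearIndependent ℚ fun i => antiVec (Φ i) (1 : G)) :
    Fintype.card I ≤ Module.finrank ℚ A :=
  (linearIndependent_mk Φ hu hli).fintype_card_le_finrank

/-- **The CM-type dress**: `A` = the `ρ`-odd weights `f(ρx) = −f(x)`, `P f = (f − f∘ρ)/2`.  If every equivariant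
`T : ℚ^X → ℚ^X` with `ρ`-odd values is a multiple of `f ↦ f − f∘ρ` (multiplicity one of the odd part), then a same-slot
family of CM types for `ρ` is additive ⟺ its type vectors are linearly independent. [cite: Mai1989, §2 Prop. 1 (proof)]
[cite: Deligne1982HodgeCycles, I Ex. 3.7] -/
theorem forall_map_slotExt_le_iff_linearIndependent_of_isCMTypeWith [Nonempty X] {ρ : G} (Φ : I → Set X)
    (h : ∀ i, IsCMTypeWith ρ (Φ i))
    (hM1 : ∀ T : (X → ℚ) →ₗ[ℚ] (X → ℚ), (∀ (g : G) (f : X → ℚ), T (fun x => f (g⁻¹ • x)) = fun x => T f (g⁻¹ • x)) →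
      (∀ f x, T f (ρ • x) = -T f x) → ∃ c : ℚ, ∀ f, T f = c • fun x => f x - f (ρ • x)) :
    (∀ i, (antiSpan G (Φ i)).map (slotExt (E := fun _ : I => X) i) ≤ antiSpan G (sigmaType (E := fun _ : I => X) Φ)) ↔
      LinearIndependent ℚ fun i => antiVec (Φ i) (1 : G) := by
  rcases isEmpty_or_nonempty I with hI | ⟨⟨i₀⟩⟩
  · exact ⟨fun _ => linearIndependent_empty_type, fun _ i => (IsEmpty.false i).elim⟩
  have hρ := h i₀
  let A : Submodule ℚ (X → ℚ) := antiWeights ρ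
  have hmemA : ∀ f : X → ℚ, f ∈ A ↔ ∀ x, f (ρ • x) = -f x := fun f => Iff.rfl
  let P : (X → ℚ) →ₗ[ℚ] (X → ℚ) := (1 / 2 : ℚ) • (LinearMap.id - LinearMap.funLeft ℚ ℚ fun x : X => ρ • x)
  have hP : ∀ f x, P f x = (1 / 2 : ℚ) * (f x - f (ρ • x)) := fun f x => rfl
  have hPeq : ∀ (g : G) (f : X → ℚ), P (fun x => f (g⁻¹ • x)) = fun x => P f (g⁻¹ • x) := fun g f => by
    funext x
    rw [hP, hP, hρ.comm]
  have hPA : ∀ f, P f ∈ A := fun f => (hmemA _).2 fun x => by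
    rw [hP, hP, hρ.invol]
    ring
  have hPid : ∀ a ∈ A, P a = a := fun a ha => by
    funext x
    rw [hP, (hmemA a).1 ha x]
    ring
  have hM1' : ∀ T : (X → ℚ) →ₗ[ℚ] (X → ℚ), (∀ (g : G) (f : X → ℚ), T (fun x => f (g⁻¹ • x)) = fun x => T f (g⁻¹ • x)) →
      (∀ f, T f ∈ A) → ∃ c : ℚ, ∀ f, T f = c • P f := fun T hT hTA => by
    obtain ⟨c, hc⟩ := hM1 T hT fun f => (hmemA _).1 (hTA f)
    refine ⟨2 * c, fun f => ?_⟩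
    rw [hc f]
    funext x
    simp only [Pi.smul_apply, hP, smul_eq_mul]
    ring
  have hu : ∀ i, antiVec (Φ i) (1 : G) ∈ A := fun i => (hmemA _).2 fun x => by
    simp only [antiVec, (h i).translateInd_rho_smul]
    ring
  exact forall_map_slotExt_le_iff_linearIndependent P hPeq hPA hPid hM1' Φ hu

end SameSlot

end Literature.NumberTheory.ComplexMultiplication
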